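import Mathlib
import HarnessLib
import Summits.Ventures.LatticeQCDFlow.Scoring.ChainBlockDecorrelation

/-!
# Decorrelation of the past from the future under a GEOMETRIC SUP-NORM ENVELOPE
# `|(kop κ)^[t] g − πg| ≤ 2 C_g A ρ^t`, from any start: one observation, a lag pair, and a squared
# block sum (`|E[G S²] − E[G] E[S²]| ≤ 8 (2C)² A² ((1+ρ)/(1−ρ)²) ρ^{gap} E|G|`, uniformly in the block length)

HONEST FRAMING: exact (Metropolis-corrected) sampling algorithms for lattice gauge theory;
figures of merit are autocorrelation/cost numbers at stated couplings and volumes; no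
continuum-physics claim.

Venture `LatticeQCDFlow` (cell pub-lqcd), topic `Scoring`; FANOUT row 8 (`s0-cpn-nemc`, GEN-20).
NEW WORK of the cell, not a published result; no definition is introduced; nothing is cited as a
fact.  GEN-19 proved the decorrelation of a bounded past functional from one / two future
observations and from a future squared block sum under a ONE-step minorisation `κ(x, ·) ≥ ε ν`, through
the residual-kernel structure `(kop κ)^[w] g = c + ρ^w (kop R)^[w] g`
(`Scoring/ChainBlockDecorrelation.lean`).  The composite samplers of the cell (Metropolis / heat-bath
sweeps followed by exact updates, HMC trajectories, the engine's NCMC lane) are certified by a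
minorisation of a POWER `(nHit κ m)(x, ·) ≥ ε ν` only, equivalently by uniform ergodicity.  This file
re-proves the three decorrelation statements from the one consequence every such certificate
delivers — a GEOMETRIC SUP-NORM ENVELOPE with constants `A ≥ 0`, `0 ≤ ρ < 1`:
`|(kop κ)^[t] g (x) − ∫ g dπ| ≤ 2 C_g · A ρ^t` for EVERY bounded measurable `g` (`|g| ≤ C_g`), every
`x` and every `t` (one-step Doeblin: `A = 1`, `ρ = 1 − ε`; an `m`-step Doeblin certificate gives
`ρ = 1 − ε/(m+1)`, `A = ρ^{−(m−1)}`: `Scoring/DoeblinPowerGeometricEnvelope.lean`).  The proofs are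
GEN-19's with the residual kernel replaced by the tower property in `DependsOn` form
(`Scoring/SplitChainDependsOn.chain_tower_iterate_dependsOn`, any Markov kernel) and the envelope; the
constants double (`4 C_g A ρ^w` for `2 C_g ρ^w`).  These are the covariance inputs of the consistency
of the batch-means estimator of the asymptotic variance under a Doeblin power
(`Scoring/BatchMeansCovarianceEnvelope.lean`, `Scoring/BatchMeansConsistencyEnvelope.lean`).
Printed counterparts NAMED ONLY: mixing of uniformly ergodic chains (Ibragimov 1962; Bradley 2005 §3).

## Content (`κ` Markov, `π` a probability law, envelope `(A, ρ)` as above; `P_{μ₀}` the chain's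
## path law `Kernel.trajMeasure` from ANY initial law `μ₀`; `G` bounded measurable, `DependsOn G (Set.Iic u)`)

* **`chain_dependsOn_future_decorrelation_of_envelope`** — `|g| ≤ C_g` measurable:
  `|E[G · g(X_{u+w})] − E[G] · E[g(X_{u+w})]| ≤ 4 C_g (A ρ^w) ∫ |G| dP_{μ₀}`;
* **`chain_dependsOn_futurePair_decorrelation_of_envelope`** — with `|(kop κ)^[m] g₂| ≤ B`:
  `|E[G · g₁(X_{u+w}) g₂(X_{u+w+m})] − E[G] · E[g₁(X_{u+w}) g₂(X_{u+w+m})]| ≤ 4 (C_{g₁} B) (A ρ^w) ∫ |G|`;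
* **`chain_dependsOn_blockSq_decorrelation_of_envelope`** — `π` invariant is NOT needed beyond the
  envelope; `|f| ≤ C` measurable, `f̄ = f − πf`, `S = Σ_{l<b} f̄(X_{u+g+l})`:
  `|E[G · S²] − E[G] · E[S²]| ≤ 8 (2C)² A² ((1+ρ)/(1−ρ)²) ρ^g ∫ |G| dP_{μ₀}`, uniformly in `b`.

NOT CLAIMED: sharp constants; unbounded observables; anything about a concrete sampler.
-/

noncomputable section

namespace Summit.Ventures.LatticeQCDFlow.Scoring

open MeasureTheory ProbabilityTheory Filter Finset Preorder Literature.Probability.MarkovChains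
open scoped ENNReal Topology

variable {Ω : Type*} [MeasurableSpace Ω]

section Envelope

variable {κ : Kernel Ω Ω} [IsMarkovKernel κ] {π : Measure Ω} {A ρ : ℝ}
  (μ₀ : Measure Ω) [IsProbabilityMeasure μ₀]

/-- **THE PAST AND ONE FUTURE OBSERVATION DECORRELATE GEOMETRICALLY, FROM ANY START, UNDER A
SUP-NORM ENVELOPE.**  If `|(kop κ)^[t] g − ∫ g dπ| ≤ 2 C_g A ρ^t` for every bounded measurable `g`,
then for `G` bounded measurable with `DependsOn G (Set.Iic u)` and `|g| ≤ C_g` measurable: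
`|E[G · g(X_{u+w})] − E[G] · E[g(X_{u+w})]| ≤ 4 C_g (A ρ^w) ∫ |G| dP_{μ₀}`. -/
theorem chain_dependsOn_future_decorrelation_of_envelope
    (henv : ∀ (g : Ω → ℝ), Measurable g → ∀ (Cg : ℝ), (∀ x, |g x| ≤ Cg) →
      ∀ (t : ℕ) (x : Ω), |(kop κ)^[t] g x - ∫ y, g y ∂π| ≤ 2 * Cg * (A * ρ ^ t))
    (u w : ℕ) {G : (ℕ → Ω) → ℝ}
    (hG : Measurable G) (hGd : DependsOn G (Set.Iic u)) {CG : ℝ} (hCG : ∀ x, |G x| ≤ CG)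
    {g : Ω → ℝ} (hg : Measurable g) {Cg : ℝ} (hCg : ∀ x, |g x| ≤ Cg) :
    |∫ x, G x * g (x (u + w)) ∂(Kernel.trajMeasure (X := fun _ : ℕ => Ω) μ₀
        (fun n : ℕ => κ.comap (fun h : (i : ↥(Finset.Iic n)) → Ω => h ⟨n, Finset.mem_Iic.2 le_rfl⟩)
          (measurable_pi_apply _)))
      - (∫ x, G x ∂(Kernel.trajMeasure (X := fun _ : ℕ => Ω) μ₀
        (fun n : ℕ => κ.comap (fun h : (i : ↥(Finset.Iic n)) → Ω => h ⟨n, Finset.mem_Iic.2 le_rfl⟩)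
          (measurable_pi_apply _))))
        * ∫ x, g (x (u + w)) ∂(Kernel.trajMeasure (X := fun _ : ℕ => Ω) μ₀
        (fun n : ℕ => κ.comap (fun h : (i : ↥(Finset.Iic n)) → Ω => h ⟨n, Finset.mem_Iic.2 le_rfl⟩)
          (measurable_pi_apply _)))|
      ≤ 4 * Cg * (A * ρ ^ w) * ∫ x, |G x| ∂(Kernel.trajMeasure (X := fun _ : ℕ => Ω) μ₀
        (fun n : ℕ => κ.comap (fun h : (i : ↥(Finset.Iic n)) → Ω => h ⟨n, Finset.mem_Iic.2 le_rfl⟩)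
          (measurable_pi_apply _))) := by
  set P := Kernel.trajMeasure (X := fun _ : ℕ => Ω) μ₀
      (fun n : ℕ => κ.comap (fun h : (i : ↥(Finset.Iic n)) → Ω => h ⟨n, Finset.mem_Iic.2 le_rfl⟩)
        (measurable_pi_apply _)) with hP
  obtain ⟨hKm, hKb⟩ := iterate_kop_bounded_measurable κ hg hCg w
  have hCG0 : 0 ≤ CG := (abs_nonneg _).trans (hCG (Classical.choice
    (nonempty_of_isProbabilityMeasure P)))
  set c : ℝ := ∫ y, g y ∂π with hc
  -- the envelope remainder `R = K^w g − c`, `|R| ≤ δ`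
  set δ : ℝ := 2 * Cg * (A * ρ ^ w) with hδ
  have hRb : ∀ y, |(kop κ)^[w] g y - c| ≤ δ := fun y => henv g hg Cg hCg w y
  have hδ0 : 0 ≤ δ := (abs_nonneg _).trans (hRb (Classical.choice
    (nonempty_of_isProbabilityMeasure μ₀)))
  have hRm : Measurable fun y => (kop κ)^[w] g y - c := hKm.sub_const c
  -- tower: `E[G g(X_{u+w})] = E[G (K^w g)(X_u)]`, and the same with `G = 1`
  have h1 := chain_tower_iterate_dependsOn κ μ₀ u w hG hGd hCG hg hCg
  rw [← hP] at h1
  have h2 := chain_tower_iterate_dependsOn κ μ₀ u w (G := fun _ => (1 : ℝ)) measurable_const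
    ((dependsOn_const (1 : ℝ)).mono (Set.empty_subset _)) (CG := 1) (fun _ => by simp) hg hCg
  rw [← hP] at h2
  simp only [one_mul] at h2
  have hiG : Integrable G P := integrable_of_bounded P hG hCG
  have hiGR : Integrable (fun x : ℕ → Ω => G x * ((kop κ)^[w] g (x u) - c)) P :=
    integrable_of_bounded P (hG.mul (hRm.comp (measurable_pi_apply _))) (C := CG * δ) fun x => by
      rw [abs_mul]; exact mul_le_mul (hCG x) (hRb _) (abs_nonneg _) hCG0
  have hiR : Integrable (fun x : ℕ → Ω => (kop κ)^[w] g (x u) - c) P :=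
    integrable_of_bounded P (hRm.comp (measurable_pi_apply _)) fun x => hRb _
  have hA : ∫ x, G x * g (x (u + w)) ∂P
      = c * ∫ x, G x ∂P + ∫ x, G x * ((kop κ)^[w] g (x u) - c) ∂P := by
    rw [h1]
    have hpt : ∀ x : ℕ → Ω, G x * (kop κ)^[w] g (x u)
        = c * G x + G x * ((kop κ)^[w] g (x u) - c) := fun x => by ring
    rw [integral_congr_ae (ae_of_all _ hpt), integral_add (hiG.const_mul c) hiGR, integral_const_mul]
  have hB : ∫ x, g (x (u + w)) ∂P = c + ∫ x, ((kop κ)^[w] g (x u) - c) ∂P := by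
    rw [h2]
    have hpt : ∀ x : ℕ → Ω, (kop κ)^[w] g (x u) = c + ((kop κ)^[w] g (x u) - c) := fun x => by ring
    rw [integral_congr_ae (ae_of_all _ hpt), integral_add (integrable_const c) hiR,
      integral_const, probReal_univ, one_smul]
  have hdiff : ∫ x, G x * g (x (u + w)) ∂P - (∫ x, G x ∂P) * ∫ x, g (x (u + w)) ∂P
      = ∫ x, G x * ((kop κ)^[w] g (x u) - c) ∂P
        - (∫ x, G x ∂P) * ∫ x, ((kop κ)^[w] g (x u) - c) ∂P := by
    rw [hA, hB]; ring
  rw [hdiff]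
  -- the three elementary bounds
  have hb1 : |∫ x, G x * ((kop κ)^[w] g (x u) - c) ∂P| ≤ δ * ∫ x, |G x| ∂P := by
    calc |∫ x, G x * ((kop κ)^[w] g (x u) - c) ∂P| ≤ ∫ x, |G x * ((kop κ)^[w] g (x u) - c)| ∂P :=
          abs_integral_le_integral_abs
      _ ≤ ∫ x, δ * |G x| ∂P := by
          refine integral_mono_of_nonneg (ae_of_all _ fun x => abs_nonneg _) (hiG.abs.const_mul δ)
            (ae_of_all _ fun x => ?_)
          show |G x * ((kop κ)^[w] g (x u) - c)| ≤ δ * |G x|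
          rw [abs_mul, mul_comm]
          exact mul_le_mul_of_nonneg_right (hRb _) (abs_nonneg _)
      _ = δ * ∫ x, |G x| ∂P := integral_const_mul _ _
  have hb2 : |∫ x, G x ∂P| ≤ ∫ x, |G x| ∂P := abs_integral_le_integral_abs
  have hb3 : |∫ x, ((kop κ)^[w] g (x u) - c) ∂P| ≤ δ := by
    calc |∫ x, ((kop κ)^[w] g (x u) - c) ∂P| = ‖∫ x, ((kop κ)^[w] g (x u) - c) ∂P‖ :=
          (Real.norm_eq_abs _).symm
      _ ≤ δ * P.real Set.univ := norm_integral_le_of_norm_le_const (Eventually.of_forall fun x => by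
          rw [Real.norm_eq_abs]; exact hRb _)
      _ = δ := by rw [probReal_univ, mul_one]
  have hI0 : 0 ≤ ∫ x, |G x| ∂P := integral_nonneg fun x => abs_nonneg _
  have hprod : |(∫ x, G x ∂P) * ∫ x, ((kop κ)^[w] g (x u) - c) ∂P| ≤ (∫ x, |G x| ∂P) * δ := by
    rw [abs_mul]; exact mul_le_mul hb2 hb3 (abs_nonneg _) hI0
  calc |∫ x, G x * ((kop κ)^[w] g (x u) - c) ∂P
        - (∫ x, G x ∂P) * ∫ x, ((kop κ)^[w] g (x u) - c) ∂P|
      ≤ δ * ∫ x, |G x| ∂P + (∫ x, |G x| ∂P) * δ := (abs_sub _ _).trans (add_le_add hb1 hprod)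
    _ = 4 * Cg * (A * ρ ^ w) * ∫ x, |G x| ∂P := by rw [hδ]; ring

/-- **Two future times** under the envelope: with `|(kop κ)^[m] g₂| ≤ B` (for instance
`B = 2 C_{g₂} A ρ^m + |∫ g₂ dπ|`, or `B = 2 C_{g₂} A ρ^m` for a `π`-centred `g₂`):
`|E[G · g₁(X_{u+w}) g₂(X_{u+w+m})] − E[G] · E[g₁(X_{u+w}) g₂(X_{u+w+m})]| ≤ 4 (C_{g₁} B) (A ρ^w) ∫ |G|`. -/
theorem chain_dependsOn_futurePair_decorrelation_of_envelope
    (henv : ∀ (g : Ω → ℝ), Measurable g → ∀ (Cg : ℝ), (∀ x, |g x| ≤ Cg) →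
      ∀ (t : ℕ) (x : Ω), |(kop κ)^[t] g x - ∫ y, g y ∂π| ≤ 2 * Cg * (A * ρ ^ t))
    (u w m : ℕ) {G : (ℕ → Ω) → ℝ}
    (hG : Measurable G) (hGd : DependsOn G (Set.Iic u)) {CG : ℝ} (hCG : ∀ x, |G x| ≤ CG)
    {g₁ g₂ : Ω → ℝ} (hg₁ : Measurable g₁) {Cg₁ : ℝ} (hCg₁ : ∀ x, |g₁ x| ≤ Cg₁)
    (hg₂ : Measurable g₂) {Cg₂ : ℝ} (hCg₂ : ∀ x, |g₂ x| ≤ Cg₂) {B : ℝ}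
    (hB : ∀ y, |(kop κ)^[m] g₂ y| ≤ B) :
    |∫ x, G x * (g₁ (x (u + w)) * g₂ (x (u + w + m))) ∂(Kernel.trajMeasure (X := fun _ : ℕ => Ω) μ₀
        (fun n : ℕ => κ.comap (fun h : (i : ↥(Finset.Iic n)) → Ω => h ⟨n, Finset.mem_Iic.2 le_rfl⟩)
          (measurable_pi_apply _)))
      - (∫ x, G x ∂(Kernel.trajMeasure (X := fun _ : ℕ => Ω) μ₀
        (fun n : ℕ => κ.comap (fun h : (i : ↥(Finset.Iic n)) → Ω => h ⟨n, Finset.mem_Iic.2 le_rfl⟩)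
          (measurable_pi_apply _))))
        * ∫ x, g₁ (x (u + w)) * g₂ (x (u + w + m)) ∂(Kernel.trajMeasure (X := fun _ : ℕ => Ω) μ₀
        (fun n : ℕ => κ.comap (fun h : (i : ↥(Finset.Iic n)) → Ω => h ⟨n, Finset.mem_Iic.2 le_rfl⟩)
          (measurable_pi_apply _)))|
      ≤ 4 * (Cg₁ * B) * (A * ρ ^ w) * ∫ x, |G x| ∂(Kernel.trajMeasure (X := fun _ : ℕ => Ω) μ₀
        (fun n : ℕ => κ.comap (fun h : (i : ↥(Finset.Iic n)) → Ω => h ⟨n, Finset.mem_Iic.2 le_rfl⟩)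
          (measurable_pi_apply _))) := by
  set P := Kernel.trajMeasure (X := fun _ : ℕ => Ω) μ₀
      (fun n : ℕ => κ.comap (fun h : (i : ↥(Finset.Iic n)) → Ω => h ⟨n, Finset.mem_Iic.2 le_rfl⟩)
        (measurable_pi_apply _)) with hP
  obtain ⟨hKm, -⟩ := iterate_kop_bounded_measurable κ hg₂ hCg₂ m
  have hCG0 : 0 ≤ CG := (abs_nonneg _).trans (hCG (Classical.choice
    (nonempty_of_isProbabilityMeasure P)))
  have hCg₁0 : 0 ≤ Cg₁ := (abs_nonneg _).trans (hCg₁ (Classical.choice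
    (nonempty_of_isProbabilityMeasure μ₀)))
  -- the lag-`m` observable `H = g₁ · K^m g₂`
  have hHm : Measurable fun y => g₁ y * (kop κ)^[m] g₂ y := hg₁.mul hKm
  have hHb : ∀ y, |g₁ y * (kop κ)^[m] g₂ y| ≤ Cg₁ * B := fun y => by
    rw [abs_mul]; exact mul_le_mul (hCg₁ y) (hB y) (abs_nonneg _) hCg₁0
  -- peel the later time: functional `G · g₁(X_{u+w})` depends on `≤ u + w`
  have hF1m : Measurable fun x : ℕ → Ω => G x * g₁ (x (u + w)) :=
    hG.mul (hg₁.comp (measurable_pi_apply _))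
  have hF1d : DependsOn (fun x : ℕ → Ω => G x * g₁ (x (u + w))) (Set.Iic (u + w)) := by
    intro x y hxy
    show G x * g₁ (x (u + w)) = G y * g₁ (y (u + w))
    rw [hGd (fun i hi => hxy i (Set.mem_Iic.2 ((Set.mem_Iic.1 hi).trans (Nat.le_add_right u w)))),
      hxy (u + w) (Set.mem_Iic.2 le_rfl)]
  have hF1b : ∀ x : ℕ → Ω, |G x * g₁ (x (u + w))| ≤ CG * Cg₁ := fun x => by
    rw [abs_mul]; exact mul_le_mul (hCG x) (hCg₁ _) (abs_nonneg _) hCG0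
  have h1 := chain_tower_iterate_dependsOn κ μ₀ (u + w) m hF1m hF1d hF1b hg₂ hCg₂
  rw [← hP] at h1
  have hF2m : Measurable fun x : ℕ → Ω => g₁ (x (u + w)) := hg₁.comp (measurable_pi_apply _)
  have hF2d : DependsOn (fun x : ℕ → Ω => g₁ (x (u + w))) (Set.Iic (u + w)) := by
    intro x y hxy
    show g₁ (x (u + w)) = g₁ (y (u + w))
    rw [hxy (u + w) (Set.mem_Iic.2 le_rfl)]
  have h2 := chain_tower_iterate_dependsOn κ μ₀ (u + w) m hF2m hF2d (fun x => hCg₁ _) hg₂ hCg₂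
  rw [← hP] at h2
  have hL : ∫ x, G x * (g₁ (x (u + w)) * g₂ (x (u + w + m))) ∂P
      = ∫ x, G x * (g₁ (x (u + w)) * (kop κ)^[m] g₂ (x (u + w))) ∂P := by
    have e1 : ∫ x, G x * (g₁ (x (u + w)) * g₂ (x (u + w + m))) ∂P
        = ∫ x, G x * g₁ (x (u + w)) * g₂ (x (u + w + m)) ∂P :=
      integral_congr_ae (ae_of_all _ fun x => by ring)
    rw [e1, h1]
    exact integral_congr_ae (ae_of_all _ fun x => by ring)
  rw [hL, h2]
  exact chain_dependsOn_future_decorrelation_of_envelope μ₀ henv u w hG hGd hCG hHm hHb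

/-- **THE PAST AND A FUTURE SQUARED BLOCK SUM DECORRELATE AT RATE `ρ^{gap}`, UNIFORMLY IN THE BLOCK
LENGTH, UNDER A SUP-NORM ENVELOPE.**  Envelope `(A, ρ)` with `0 ≤ ρ < 1`; `|f| ≤ C`
measurable, `f̄ = f − ∫ f dπ`; `G` bounded measurable with `DependsOn G (Set.Iic u)`;
`S = Σ_{l<b} f̄(X_{u+g+l})`.  For EVERY initial law `μ₀` and all `u, g, b`:
`|E[G · S²] − E[G] · E[S²]| ≤ 8 (2C)² A² ((1+ρ)/(1−ρ)²) ρ^g ∫ |G| dP_{μ₀}`. -/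
theorem chain_dependsOn_blockSq_decorrelation_of_envelope [IsProbabilityMeasure π]
    (henv : ∀ (g : Ω → ℝ), Measurable g → ∀ (Cg : ℝ), (∀ x, |g x| ≤ Cg) →
      ∀ (t : ℕ) (x : Ω), |(kop κ)^[t] g x - ∫ y, g y ∂π| ≤ 2 * Cg * (A * ρ ^ t))
    (hρ0 : 0 ≤ ρ) (hρ1 : ρ < 1)
    {f : Ω → ℝ} (hf : Measurable f) {C : ℝ} (hC : ∀ x, |f x| ≤ C) (u g b : ℕ)
    {G : (ℕ → Ω) → ℝ} (hG : Measurable G) (hGd : DependsOn G (Set.Iic u)) {CG : ℝ}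
    (hCG : ∀ x, |G x| ≤ CG) :
    |∫ x, G x * (∑ l ∈ Finset.range b, (f (x (u + g + l)) - ∫ z, f z ∂π)) ^ 2
        ∂(Kernel.trajMeasure (X := fun _ : ℕ => Ω) μ₀
          (fun n : ℕ => κ.comap (fun h : (i : ↥(Finset.Iic n)) → Ω => h ⟨n, Finset.mem_Iic.2 le_rfl⟩)
            (measurable_pi_apply _)))
      - (∫ x, G x ∂(Kernel.trajMeasure (X := fun _ : ℕ => Ω) μ₀
          (fun n : ℕ => κ.comap (fun h : (i : ↥(Finset.Iic n)) → Ω => h ⟨n, Finset.mem_Iic.2 le_rfl⟩)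
            (measurable_pi_apply _))))
        * ∫ x, (∑ l ∈ Finset.range b, (f (x (u + g + l)) - ∫ z, f z ∂π)) ^ 2
          ∂(Kernel.trajMeasure (X := fun _ : ℕ => Ω) μ₀
            (fun n : ℕ => κ.comap (fun h : (i : ↥(Finset.Iic n)) → Ω => h ⟨n, Finset.mem_Iic.2 le_rfl⟩)
              (measurable_pi_apply _)))|
      ≤ 8 * (2 * C) ^ 2 * A ^ 2 * ((1 + ρ) / (1 - ρ) ^ 2) * ρ ^ g
        * ∫ x, |G x| ∂(Kernel.trajMeasure (X := fun _ : ℕ => Ω) μ₀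
          (fun n : ℕ => κ.comap (fun h : (i : ↥(Finset.Iic n)) → Ω => h ⟨n, Finset.mem_Iic.2 le_rfl⟩)
            (measurable_pi_apply _))) := by
  set P := Kernel.trajMeasure (X := fun _ : ℕ => Ω) μ₀
      (fun n : ℕ => κ.comap (fun h : (i : ↥(Finset.Iic n)) → Ω => h ⟨n, Finset.mem_Iic.2 le_rfl⟩)
        (measurable_pi_apply _)) with hP
  set c := ∫ z, f z ∂π with hc
  obtain ⟨hfb, hCfb, hfb0⟩ := centred_observable_bounds π hf hC
  have hC0 : 0 ≤ C := (abs_nonneg _).trans (hC (Classical.choice (nonempty_of_isProbabilityMeasure π)))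
  have hCG0 : 0 ≤ CG := (abs_nonneg _).trans (hCG (Classical.choice
    (nonempty_of_isProbabilityMeasure P)))
  have hI0 : 0 ≤ ∫ x, |G x| ∂P := integral_nonneg fun x => abs_nonneg _
  -- the summands `a l x = f̄(x_{u+g+l})`
  set a : ℕ → (ℕ → Ω) → ℝ := fun l x => f (x (u + g + l)) - c with ha
  have ham : ∀ l, Measurable (a l) := fun l => hfb.comp (measurable_pi_apply _)
  have hab : ∀ l x, |a l x| ≤ 2 * C := fun l x => hCfb _
  -- each pair decorrelates: `|E[G a_l a_l'] − E[G] E[a_l a_l']| ≤ 8 (2C)² A² ρ^g ρ^{max l l'} ∫|G|`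
  have hord : ∀ l l', l ≤ l' →
      |∫ x, G x * (a l x * a l' x) ∂P - (∫ x, G x ∂P) * ∫ x, a l x * a l' x ∂P|
        ≤ 8 * (2 * C) ^ 2 * A ^ 2 * ρ ^ g * ρ ^ (max l l') * ∫ x, |G x| ∂P := by
    intro l l' hll'
    obtain ⟨d, rfl⟩ := Nat.exists_eq_add_of_le hll'
    have hdec : ∀ y, |(kop κ)^[d] (fun z => f z - c) y| ≤ 2 * (2 * C) * (A * ρ ^ d) := fun y => by
      have h := henv (fun z => f z - c) hfb (2 * C) hCfb d y
      rwa [hfb0, sub_zero] at h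
    have key := chain_dependsOn_futurePair_decorrelation_of_envelope μ₀ henv u
      (g + l) d hG hGd hCG hfb hCfb hfb hCfb hdec
    rw [← hP] at key
    have e1 : u + (g + l) = u + g + l := by omega
    have e2 : u + g + l + d = u + g + (l + d) := by omega
    rw [e1] at key
    rw [e2] at key
    refine key.trans (le_of_eq ?_)
    rw [max_eq_right hll', pow_add, pow_add]
    ring
  have hpair : ∀ l l',
      |∫ x, G x * (a l x * a l' x) ∂P - (∫ x, G x ∂P) * ∫ x, a l x * a l' x ∂P|
        ≤ 8 * (2 * C) ^ 2 * A ^ 2 * ρ ^ g * ρ ^ (max l l') * ∫ x, |G x| ∂P := by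
    intro l l'
    rcases le_total l l' with hll' | hl'l
    · exact hord l l' hll'
    · have hsym1 : ∫ x, G x * (a l x * a l' x) ∂P = ∫ x, G x * (a l' x * a l x) ∂P :=
        integral_congr_ae (ae_of_all _ fun x => by ring)
      have hsym2 : ∫ x, a l x * a l' x ∂P = ∫ x, a l' x * a l x ∂P :=
        integral_congr_ae (ae_of_all _ fun x => by ring)
      rw [hsym1, hsym2, max_comm]
      exact hord l' l hl'l
  -- expand the squares into double sums and integrate termwise
  have hiGaa : ∀ l l', Integrable (fun x => G x * (a l x * a l' x)) P := fun l l' =>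
    integrable_of_bounded P (hG.mul ((ham l).mul (ham l'))) (C := CG * (2 * C * (2 * C))) fun x => by
      rw [abs_mul, abs_mul]
      exact mul_le_mul (hCG x) (mul_le_mul (hab l x) (hab l' x) (abs_nonneg _) (by positivity))
        (by positivity) hCG0
  have hiaa : ∀ l l', Integrable (fun x => a l x * a l' x) P := fun l l' =>
    integrable_of_bounded P ((ham l).mul (ham l')) (C := 2 * C * (2 * C)) fun x => by
      rw [abs_mul]; exact mul_le_mul (hab l x) (hab l' x) (abs_nonneg _) (by positivity)
  have hsqG : ∀ x : ℕ → Ω, G x * (∑ l ∈ Finset.range b, a l x) ^ 2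
      = ∑ l ∈ Finset.range b, ∑ l' ∈ Finset.range b, G x * (a l x * a l' x) := fun x => by
    rw [sq, Finset.sum_mul_sum, Finset.mul_sum]
    exact Finset.sum_congr rfl fun l _ => Finset.mul_sum _ _ _
  have hsq : ∀ x : ℕ → Ω, (∑ l ∈ Finset.range b, a l x) ^ 2
      = ∑ l ∈ Finset.range b, ∑ l' ∈ Finset.range b, a l x * a l' x := fun x => by
    rw [sq, Finset.sum_mul_sum]
  have hEG : ∫ x, G x * (∑ l ∈ Finset.range b, a l x) ^ 2 ∂P
      = ∑ l ∈ Finset.range b, ∑ l' ∈ Finset.range b, ∫ x, G x * (a l x * a l' x) ∂P := by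
    rw [integral_congr_ae (ae_of_all _ hsqG), integral_finsetSum _ fun l _ =>
      integrable_finsetSum _ fun l' _ => hiGaa l l']
    exact Finset.sum_congr rfl fun l _ => integral_finsetSum _ fun l' _ => hiGaa l l'
  have hE : ∫ x, (∑ l ∈ Finset.range b, a l x) ^ 2 ∂P
      = ∑ l ∈ Finset.range b, ∑ l' ∈ Finset.range b, ∫ x, a l x * a l' x ∂P := by
    rw [integral_congr_ae (ae_of_all _ hsq), integral_finsetSum _ fun l _ =>
      integrable_finsetSum _ fun l' _ => hiaa l l']
    exact Finset.sum_congr rfl fun l _ => integral_finsetSum _ fun l' _ => hiaa l l'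
  have hgoal : ∫ x, G x * (∑ l ∈ Finset.range b, a l x) ^ 2 ∂P
      - (∫ x, G x ∂P) * ∫ x, (∑ l ∈ Finset.range b, a l x) ^ 2 ∂P
      = ∑ l ∈ Finset.range b, ∑ l' ∈ Finset.range b,
          (∫ x, G x * (a l x * a l' x) ∂P - (∫ x, G x ∂P) * ∫ x, a l x * a l' x ∂P) := by
    rw [hEG, hE, Finset.mul_sum]
    simp_rw [Finset.mul_sum, ← Finset.sum_sub_distrib]
  show |∫ x, G x * (∑ l ∈ Finset.range b, a l x) ^ 2 ∂P
      - (∫ x, G x ∂P) * ∫ x, (∑ l ∈ Finset.range b, a l x) ^ 2 ∂P|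
    ≤ 8 * (2 * C) ^ 2 * A ^ 2 * ((1 + ρ) / (1 - ρ) ^ 2) * ρ ^ g * ∫ x, |G x| ∂P
  rw [hgoal]
  calc |∑ l ∈ Finset.range b, ∑ l' ∈ Finset.range b,
          (∫ x, G x * (a l x * a l' x) ∂P - (∫ x, G x ∂P) * ∫ x, a l x * a l' x ∂P)|
      ≤ ∑ l ∈ Finset.range b, ∑ l' ∈ Finset.range b,
          |∫ x, G x * (a l x * a l' x) ∂P - (∫ x, G x ∂P) * ∫ x, a l x * a l' x ∂P| :=
        (Finset.abs_sum_le_sum_abs _ _).trans (Finset.sum_le_sum fun l _ =>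
          Finset.abs_sum_le_sum_abs _ _)
    _ ≤ ∑ l ∈ Finset.range b, ∑ l' ∈ Finset.range b,
          (8 * (2 * C) ^ 2 * A ^ 2 * ρ ^ g * ∫ x, |G x| ∂P) * ρ ^ (max l l') :=
        Finset.sum_le_sum fun l _ => Finset.sum_le_sum fun l' _ =>
          (hpair l l').trans (le_of_eq (by ring))
    _ = ∑ k ∈ Finset.range b, (2 * (k : ℝ) + 1)
          * ((8 * (2 * C) ^ 2 * A ^ 2 * ρ ^ g * ∫ x, |G x| ∂P) * ρ ^ k) :=
        sum_sum_max (fun k => (8 * (2 * C) ^ 2 * A ^ 2 * ρ ^ g * ∫ x, |G x| ∂P) * ρ ^ k) b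
    _ = (8 * (2 * C) ^ 2 * A ^ 2 * ρ ^ g * ∫ x, |G x| ∂P)
          * ∑ k ∈ Finset.range b, (2 * (k : ℝ) + 1) * ρ ^ k := by
        rw [Finset.mul_sum]
        exact Finset.sum_congr rfl fun k _ => by ring
    _ ≤ (8 * (2 * C) ^ 2 * A ^ 2 * ρ ^ g * ∫ x, |G x| ∂P) * ((1 + ρ) / (1 - ρ) ^ 2) :=
        mul_le_mul_of_nonneg_left (sum_range_odd_mul_pow_le hρ0 hρ1 b) (by positivity)
    _ = 8 * (2 * C) ^ 2 * A ^ 2 * ((1 + ρ) / (1 - ρ) ^ 2) * ρ ^ g * ∫ x, |G x| ∂P := by ring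

end Envelope

end Summit.Ventures.LatticeQCDFlow.Scoring

end
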